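import Summits.HodgeConjecture.HodgeConjecture.Theorems.K2E5QuatZetaAbsConv   -- ★ (g) p855899: `quatZetaAbsConv` (integrability for σ > 1); brings (α) continuity, (β) `quatModule_unitsOne_mul_section`, ★ #3j-bis `continuous_quatModuleSection`
import Mathlib.MeasureTheory.Integral.Prod
import HarnessLib

/-!
# K2 ∕ E5 «TamagawaUnitary» — tier-2 file `K2E5QuatZetaSplit`: layer (R1) of the G3 residue — `Z(Φ, s) = ∫_ℝ e^{st} (∫_{D^{(1)}} Φ(y θ_{e^t}) dx¹) dt`

Track B «K2-LIT», engine E5, crux H413 (`stmt-HodgeConjecture-24833`); seat K2E5-p07 (g0), G3 RESIDUE LEAD (K2E5-plan (g2) SWEEP #12b (26)).  Pays the parts `hIm` and `hZ` of ★ (R0)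
`K2E5QuatZetaResidueOfParts.quatZetaResidue_of_parts` BY THEIR BYTES:
* §1 the central ray `t ↦ θ_{e^t} = quatModuleSection (e^t)` is continuous, so is `(t, y) ↦ y θ_{e^t}` on `ℝ × D^{(1)}_{h,𝔸}`;
* §2 `map_rayMul_eq` — Tate's disintegration hypothesis of socket G3 (`∫⁻ f ∂dx = ∫⁻ t, ∫⁻ y, f(y θ_{e^t}) ∂dx¹` for Borel `f ≥ 0`) says EXACTLY `dx = (t, y) ↦ y θ_{e^t})_* (dt ⊗ dx¹)`
  (Tonelli on indicators); hence the BOCHNER disintegration `integral_eq_integral_ray` `∫ F ∂dx = ∫ t, ∫ y, F(y θ_{e^t}) ∂dx¹ dt` for every `dx`-integrable Borel `F`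
  (for R4's use as well), and `aestronglyMeasurable_integral_ray`;
* §3 THE PARTS: `aestronglyMeasurable_inner` (= `hIm`) and `quatZeta_eq_integral_exp_mul_inner` (= `hZ`): for real `s > 1`, `Z(Φ, s; dx) = ∫_ℝ e^{st} · (∫ Φ(y θ_{e^t}) dx¹(y)) dt`,
  Fubini being licensed by ★ (g) `K2E5QuatZetaAbsConv.quatZetaAbsConv` and `|det(y θ_{e^t})|_𝔸 = e^t` (★ (β) `quatModule_unitsOne_mul_section`).
No `sorry`, no `instance`, no `notation`, axioms ⊆ the trio.

HONEST LABEL: HC_CM is proved only modulo the 7 printed citations (2 remaining named inputs: hLiu418 = stmt-HodgeConjecture-24832, h413 = stmt-HodgeConjecture-24833) until rung 0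
closes; this file is a helper (`--supports stmt-HodgeConjecture-24833 --as helper`) and changes no count.

## References
[TateThesis1967] J. Tate, in Cassels–Fröhlich (1967), Ch. XV §4.4 · [WeilBNT1967] A. Weil, *Basic Number Theory* (1967), Ch. VII §5 Prop. 11 · [VignerasLNM800] M.-F. Vignéras,
LNM 800 (1980), Ch. III §2 Thm. 2.2.
-/

set_option autoImplicit false
set_option linter.dupNamespace false

noncomputable section

namespace Summit.HodgeConjecture.HodgeConjecture.Cruxes.H413.K2E5QuatZetaSplit

open NumberField IsDedekindDomain MeasureTheory MeasureTheory.Measure Filter Topology Set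
open scoped Matrix MatrixGroups NNReal ENNReal
open Literature.MeasureTheory.Group Literature.NumberTheory Literature.NumberTheory.Automorphic
open Literature.AlgebraicGeometry.ShimuraVarieties (hermForm)
open Summit.HodgeConjecture.HodgeConjecture.Cruxes.H413.K2E5QuatAdelicMatrixModel
open Summit.HodgeConjecture.HodgeConjecture.Cruxes.H413.K2E5QuatZeta
open Summit.HodgeConjecture.HodgeConjecture.Cruxes.H413.K2E5QuatAdelicLattice
open Summit.HodgeConjecture.HodgeConjecture.Cruxes.H413.K2E5QuatAdelicModuleOne
open Summit.HodgeConjecture.HodgeConjecture.Cruxes.H413.K2E5QuatZetaAbsConvReduction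
open Summit.HodgeConjecture.HodgeConjecture.Cruxes.H413.K2E5QuatZetaAbsConvOfThetaBounds

variable (L : Type) [Field L] [NumberField L] [IsCMField L] (Ha : Matrix (Fin 2) (Fin 2) L)

/-! ## §1 The central ray and the ray multiplication map are continuous -/

/-- The central ray `t ↦ θ_{e^t} = quatModuleSection (e^t)` is continuous. [folklore] -/
theorem continuous_sectionRay :
    Continuous fun t : ℝ => quatModuleSection L Ha (Units.mk0 (Real.toNNReal (Real.exp t)) (Real.toNNReal_pos.2 (Real.exp_pos t)).ne') := by
  refine (continuous_quatModuleSection L Ha).comp (Units.continuous_iff.2 ⟨?_, ?_⟩)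
  · exact continuous_real_toNNReal.comp Real.continuous_exp
  · simp only [Units.val_inv_eq_inv_val, Units.val_mk0]
    exact (continuous_real_toNNReal.comp Real.continuous_exp).inv₀ fun t => (Real.toNNReal_pos.2 (Real.exp_pos t)).ne'

/-- The ray multiplication `(t, y) ↦ y · θ_{e^t} : ℝ × D^{(1)}_{h,𝔸} → (D_h ⊗ 𝔸)^×` is continuous. [folklore] -/
theorem continuous_rayMul :
    Continuous fun p : ℝ × ↥(quatAdelicUnitsOne L Ha) => (p.2 : ↥(quatAdelicUnits L Ha)) *
      quatModuleSection L Ha (Units.mk0 (Real.toNNReal (Real.exp p.1)) (Real.toNNReal_pos.2 (Real.exp_pos p.1)).ne') :=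
  (continuous_subtype_val.comp continuous_snd).mul ((continuous_sectionRay L Ha).comp continuous_fst)

/-! ## §2 Tate's disintegration hypothesis as a push-forward identity, and its Bochner form -/

section Disintegration

variable [MeasurableSpace (GL (Fin 2) (AdeleRing (𝓞 L) L))] [BorelSpace (GL (Fin 2) (AdeleRing (𝓞 L) L))]
  [SecondCountableTopology ↥(quatAdelicUnitsOne L Ha)]

/-- **`dx = (t, y) ↦ y θ_{e^t})_* (dt ⊗ dx¹)`**: the disintegration hypothesis of socket G3 (stated for Borel `f ≥ 0`) is the statement that `dx` is the push-forward of
`Lebesgue ⊗ dx¹` under the ray multiplication (apply it to indicators; Tonelli). [cite: TateThesis1967, §4.4] [cite: WeilBNT1967, Ch. VII §5] -/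
theorem map_rayMul_eq (dx : Measure ↥(quatAdelicUnits L Ha)) (dx1 : Measure ↥(quatAdelicUnitsOne L Ha)) [SFinite dx1]
    (hdis : ∀ f : ↥(quatAdelicUnits L Ha) → ℝ≥0∞, Measurable f →
      ∫⁻ x, f x ∂dx = ∫⁻ t : ℝ, ∫⁻ y, f ((y : ↥(quatAdelicUnits L Ha)) *
        quatModuleSection L Ha (Units.mk0 (Real.toNNReal (Real.exp t)) (Real.toNNReal_pos.2 (Real.exp_pos t)).ne')) ∂dx1) :
    Measure.map (fun p : ℝ × ↥(quatAdelicUnitsOne L Ha) => (p.2 : ↥(quatAdelicUnits L Ha)) *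
      quatModuleSection L Ha (Units.mk0 (Real.toNNReal (Real.exp p.1)) (Real.toNNReal_pos.2 (Real.exp_pos p.1)).ne')) (volume.prod dx1) = dx := by
  have hm := (continuous_rayMul L Ha).measurable
  refine Measure.ext fun S hS => ?_
  rw [Measure.map_apply hm hS, ← lintegral_indicator_one hS, hdis _ (measurable_one.indicator hS), ← lintegral_indicator_one (hm hS),
    lintegral_prod _ ((measurable_one.indicator (hm hS)).aemeasurable)]
  rfl

/-- **BOCHNER DISINTEGRATION ALONG THE RAY**: `∫ F ∂dx = ∫_ℝ ∫_{D^{(1)}} F(y θ_{e^t}) dx¹(y) dt` for every `dx`-integrable `F : (D_h ⊗ 𝔸)^× → ℂ` (push-forward + Fubini).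
[cite: TateThesis1967, §4.4] [cite: WeilBNT1967, Ch. VII §5 Prop. 11] -/
theorem integral_eq_integral_ray (dx : Measure ↥(quatAdelicUnits L Ha)) (dx1 : Measure ↥(quatAdelicUnitsOne L Ha)) [SFinite dx1]
    (hdis : ∀ f : ↥(quatAdelicUnits L Ha) → ℝ≥0∞, Measurable f →
      ∫⁻ x, f x ∂dx = ∫⁻ t : ℝ, ∫⁻ y, f ((y : ↥(quatAdelicUnits L Ha)) *
        quatModuleSection L Ha (Units.mk0 (Real.toNNReal (Real.exp t)) (Real.toNNReal_pos.2 (Real.exp_pos t)).ne')) ∂dx1)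
    {F : ↥(quatAdelicUnits L Ha) → ℂ} (hF : Integrable F dx) :
    ∫ x, F x ∂dx = ∫ t : ℝ, ∫ y : ↥(quatAdelicUnitsOne L Ha), F ((y : ↥(quatAdelicUnits L Ha)) *
      quatModuleSection L Ha (Units.mk0 (Real.toNNReal (Real.exp t)) (Real.toNNReal_pos.2 (Real.exp_pos t)).ne')) ∂dx1 := by
  have hm := (continuous_rayMul L Ha).measurable
  have hmap := map_rayMul_eq L Ha dx dx1 hdis
  have hF' : Integrable F (Measure.map (fun p : ℝ × ↥(quatAdelicUnitsOne L Ha) => (p.2 : ↥(quatAdelicUnits L Ha)) *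
      quatModuleSection L Ha (Units.mk0 (Real.toNNReal (Real.exp p.1)) (Real.toNNReal_pos.2 (Real.exp_pos p.1)).ne')) (volume.prod dx1)) := by
    rwa [hmap]
  have hcomp : Integrable (fun p : ℝ × ↥(quatAdelicUnitsOne L Ha) => F ((p.2 : ↥(quatAdelicUnits L Ha)) *
      quatModuleSection L Ha (Units.mk0 (Real.toNNReal (Real.exp p.1)) (Real.toNNReal_pos.2 (Real.exp_pos p.1)).ne'))) (volume.prod dx1) :=
    (integrable_map_measure hF'.aestronglyMeasurable hm.aemeasurable).1 hF'
  calc ∫ x, F x ∂dx = ∫ x, F x ∂(Measure.map (fun p : ℝ × ↥(quatAdelicUnitsOne L Ha) => (p.2 : ↥(quatAdelicUnits L Ha)) *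
        quatModuleSection L Ha (Units.mk0 (Real.toNNReal (Real.exp p.1)) (Real.toNNReal_pos.2 (Real.exp_pos p.1)).ne')) (volume.prod dx1)) := by rw [hmap]
    _ = ∫ p : ℝ × ↥(quatAdelicUnitsOne L Ha), F ((p.2 : ↥(quatAdelicUnits L Ha)) *
        quatModuleSection L Ha (Units.mk0 (Real.toNNReal (Real.exp p.1)) (Real.toNNReal_pos.2 (Real.exp_pos p.1)).ne')) ∂(volume.prod dx1) :=
          integral_map hm.aemeasurable hF'.aestronglyMeasurable
    _ = _ := integral_prod _ hcomp

/-- The ray integral `t ↦ ∫ F(y θ_{e^t}) dx¹(y)` of a continuous `F` is a.e.-strongly measurable in `t` (Fubini). [folklore] -/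
theorem aestronglyMeasurable_integral_ray (dx1 : Measure ↥(quatAdelicUnitsOne L Ha)) [SFinite dx1] {F : ↥(quatAdelicUnits L Ha) → ℂ} (hF : Continuous F) :
    AEStronglyMeasurable (fun t : ℝ => ∫ y : ↥(quatAdelicUnitsOne L Ha), F ((y : ↥(quatAdelicUnits L Ha)) *
      quatModuleSection L Ha (Units.mk0 (Real.toNNReal (Real.exp t)) (Real.toNNReal_pos.2 (Real.exp_pos t)).ne')) ∂dx1) volume :=
  ((hF.comp (continuous_rayMul L Ha)).aestronglyMeasurable (μ := volume.prod dx1)).integral_prod_right'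

end Disintegration

/-! ## §3 The parts `hIm` and `hZ` of ★ (R0) `quatZetaResidue_of_parts` -/

section Parts

set_option synthInstance.maxHeartbeats 400000
set_option maxHeartbeats 1600000

variable {Ha} (hHa : (Ha.map (cmConjRingHom L)).transpose = Ha) (hdet : Ha.det ≠ 0)
  [MeasurableSpace (GL (Fin 2) (AdeleRing (𝓞 L) L))] [BorelSpace (GL (Fin 2) (AdeleRing (𝓞 L) L))]
  [MeasurableSpace (↥(quatAdelicUnitsOne L Ha) ⧸ quatRatLatticeOne L Ha)] [BorelSpace (↥(quatAdelicUnitsOne L Ha) ⧸ quatRatLatticeOne L Ha)]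
  [LocallyCompactSpace ↥(quatAdelicUnitsOne L Ha)] [SecondCountableTopology ↥(quatAdelicUnitsOne L Ha)] [T2Space ↥(quatAdelicUnitsOne L Ha)]

omit [MeasurableSpace (↥(quatAdelicUnitsOne L Ha) ⧸ quatRatLatticeOne L Ha)] [BorelSpace (↥(quatAdelicUnitsOne L Ha) ⧸ quatRatLatticeOne L Ha)]
  [LocallyCompactSpace ↥(quatAdelicUnitsOne L Ha)] [T2Space ↥(quatAdelicUnitsOne L Ha)] in
/-- **PART `hIm` of ★ (R0)**: the inner integral `I(t) = ∫ Φ(y θ_{e^t}) dx¹(y)` is a.e.-strongly measurable in `t`. [folklore] -/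
theorem aestronglyMeasurable_inner (dx1 : Measure ↥(quatAdelicUnitsOne L Ha)) [SFinite dx1]
    {Φ : Matrix (Fin 2) (Fin 2) (AdeleRing (𝓞 L) L) → ℂ}
    (hΦ : Φ ∈ quatSchwartzBruhat L (fun i => ((quatBasis L Ha hHa hdet i : ↥(quatRatSubalgebra L Ha)) : Matrix (Fin 2) (Fin 2) L))) :
    AEStronglyMeasurable (fun t : ℝ => ∫ y : ↥(quatAdelicUnitsOne L Ha), Φ ((((y : ↥(quatAdelicUnits L Ha)) *
        quatModuleSection L Ha (Units.mk0 (Real.toNNReal (Real.exp t)) (Real.toNNReal_pos.2 (Real.exp_pos t)).ne') : ↥(quatAdelicUnits L Ha)) :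
          GL (Fin 2) (AdeleRing (𝓞 L) L)) : Matrix (Fin 2) (Fin 2) (AdeleRing (𝓞 L) L)) ∂dx1) volume :=
  aestronglyMeasurable_integral_ray L Ha dx1 (continuous_testFunction_restrict L hHa hdet hΦ)

/-- **PART `hZ` of ★ (R0) — THE SPLIT ALONG THE CENTRAL RAY**: for real `s > 1`, `Z(Φ, s; dx) = ∫_ℝ e^{st} · (∫ Φ(y θ_{e^t}) dx¹(y)) dt` (Tate's disintegration `hdis` +
`|det(y θ_{e^t})| = e^t` + Fubini, licensed by ★ (g) `quatZetaAbsConv`). [cite: TateThesis1967, §4.4] [cite: WeilBNT1967, Ch. VII §5 Prop. 11] [cite: VignerasLNM800, Ch. III §2 Thm. 2.2] -/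
theorem quatZeta_eq_integral_exp_mul_inner (hanis : ∀ x : Fin 2 → L, hermForm (cmConjRingHom L) Ha x x = 0 → x = 0)
    (dx : Measure ↥(quatAdelicUnits L Ha))
    (dx1 : Measure ↥(quatAdelicUnitsOne L Ha)) [dx1.IsHaarMeasure] [dx1.IsMulRightInvariant]
    [(count : Measure ↥(quatRatLatticeOne L Ha)).IsHaarMeasure]
    (hdis : ∀ f : ↥(quatAdelicUnits L Ha) → ℝ≥0∞, Measurable f →
      ∫⁻ x, f x ∂dx = ∫⁻ t : ℝ, ∫⁻ y, f ((y : ↥(quatAdelicUnits L Ha)) *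
        quatModuleSection L Ha (Units.mk0 (Real.toNNReal (Real.exp t)) (Real.toNNReal_pos.2 (Real.exp_pos t)).ne')) ∂dx1)
    {Φ : Matrix (Fin 2) (Fin 2) (AdeleRing (𝓞 L) L) → ℂ}
    (hΦ : Φ ∈ quatSchwartzBruhat L (fun i => ((quatBasis L Ha hHa hdet i : ↥(quatRatSubalgebra L Ha)) : Matrix (Fin 2) (Fin 2) L)))
    {s : ℝ} (hs : 1 < s) :
    quatZeta L Ha dx Φ (s : ℂ) = ∫ t : ℝ, (Real.exp (s * t) : ℂ) *
      ∫ y : ↥(quatAdelicUnitsOne L Ha), Φ ((((y : ↥(quatAdelicUnits L Ha)) *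
        quatModuleSection L Ha (Units.mk0 (Real.toNNReal (Real.exp t)) (Real.toNNReal_pos.2 (Real.exp_pos t)).ne') : ↥(quatAdelicUnits L Ha)) :
          GL (Fin 2) (AdeleRing (𝓞 L) L)) : Matrix (Fin 2) (Fin 2) (AdeleRing (𝓞 L) L)) ∂dx1 := by
  have hint := K2E5QuatZetaAbsConv.quatZetaAbsConv L hHa hdet hanis dx dx1 hdis hΦ hs
  rw [quatZeta_def, integral_eq_integral_ray L Ha dx dx1 hdis hint]
  refine integral_congr_ae (Eventually.of_forall fun t => ?_)
  -- on the ray `|det| = e^t`, so the character is the constant `e^{st}`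
  have hmod : ∀ y : ↥(quatAdelicUnitsOne L Ha), (((quatModule L Ha ((y : ↥(quatAdelicUnits L Ha)) *
      quatModuleSection L Ha (Units.mk0 (Real.toNNReal (Real.exp t)) (Real.toNNReal_pos.2 (Real.exp_pos t)).ne')) : ℝ≥0) : ℝ) : ℂ) ^ (s : ℂ) =
        (Real.exp (s * t) : ℂ) := by
    intro y
    rw [quatModule_unitsOne_mul_section, ← Complex.ofReal_cpow (Real.exp_pos t).le, ← Real.exp_mul, mul_comm]
  simp only [hmod]
  rw [← integral_const_mul]
  refine integral_congr_ae (Eventually.of_forall fun y => ?_)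
  simp only [mul_comm]

end Parts

end Summit.HodgeConjecture.HodgeConjecture.Cruxes.H413.K2E5QuatZetaSplit

end
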